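import Summits.QuantumFields.YangMills.Theses.ParabolicTrajectory
import Literature.MathematicalPhysics.QuantumFieldTheory.BlockScaleEffectivePerturbation

/-!
# Sketch — first lemmas of the crux idea cards for `ParabolicTrajectory.TunedSequenceExists`
(stmt-QuantumFields-10524; planner-cruxidea …-10524-1-0, round 1, ideator 1).

Card 1 `block-conditioned-covariance`: `TotalCovarianceLowerBound` (abstract glue, elementary) and
`BlockConditionedWindow` (the load-bearing conditional estimate, uniform in the block field).
Card 2 `transport-to-fixed-distance`: `TransportToCoarsePlaquette` (one-insertion linear transport
of the plaquette down Bałaban's flow) and `FixedWindowLowerBound` (fixed coarse distance, fixed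
large coupling, robust under Bałaban-format terms, uniform in the volume).
Nothing here is proved; every `def … : Prop` only has to elaborate.
-/

open MeasureTheory Filter Topology
open Literature.MathematicalPhysics.QuantumFieldTheory Literature.MathematicalPhysics.QuantumLattice

namespace Summit.QuantumFields.YangMills.Cruxes.TunedSequenceExists.Sketch

/-- Card 1, glue (law of total covariance, Popoviciu + Cauchy–Schwarz on the conditional means):
if the conditional covariance of `f, g` given `m` is a.s. `≥ θ` and the conditional means are a.s.
within `ε₁, ε₂` of constants, then `Cov(f,g) ≥ θ - ε₁ ε₂`. Elementary; stated, not proved. -/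
def TotalCovarianceLowerBound : Prop :=
  ∀ (Ω : Type) (m m₀ : MeasurableSpace Ω) (μ : Measure Ω) [IsProbabilityMeasure μ] (f g : Ω → ℝ)
    (θ ε₁ ε₂ a b Cf Cg : ℝ), m ≤ m₀ → Measurable f → Measurable g → (∀ ω, |f ω| ≤ Cf) →
    (∀ ω, |g ω| ≤ Cg) →
    (∀ᵐ ω ∂μ, θ ≤ (μ[f * g|m]) ω - (μ[f|m]) ω * (μ[g|m]) ω) →
    (∀ᵐ ω ∂μ, |(μ[f|m]) ω - a| ≤ ε₁) → (∀ᵐ ω ∂μ, |(μ[g|m]) ω - b| ≤ ε₂) →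
      θ - ε₁ * ε₂ ≤ ∫ ω, f ω * g ω ∂μ - (∫ ω, f ω ∂μ) * ∫ ω, g ω ∂μ

/-- Card 1, load-bearing first lemma (UV window + block conditioning, IR never integrated).
For every compact simple `G`, lattice representation `r`, `M ≥ 2` there are a block excess `K+1`,
`θ₁ > 0`, `C` such that for all large `n` some `β ≥ n` (intended: the bare coupling whose running
coupling at scale `(K+1)·Mⁿ` is a fixed small `g*`, so `β ≈ 2b₀ log((K+1)Mⁿ) + g*⁻²`) satisfies, on
EVERY fine torus of side `(K+1)·Mⁿ·S`, with `m` the σ-algebra generated by Bałaban's axial block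
averaging to block size `b = (K+1)·Mⁿ` (block field `V = link U` on the coarse torus of side `S`):
(i) a.s. in `V`, the conditional covariance of the action densities at `0` and at `Mⁿ e₀` is
`≥ θ₁ · M^{-8n}`; (ii) a.s. in `V`, both conditional means lie within `C · b⁻⁴` of constants.
With `TotalCovarianceLowerBound` this gives `M^{8n} Cov ≥ θ₁ - C² (K+1)⁻⁸ ≥ θ₁/2` uniformly in `S`,
i.e. the correlator lower bound behind the crux on these tori (odd sides `2L+1` need an averaging
with a defect strip — remark in the card). -/
def BlockConditionedWindow : Prop :=
  ∀ (G : Type) [Group G] [TopologicalSpace G] [IsTopologicalGroup G] [CompactSpace G],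
    IsCompactSimpleLieGroup G →
      letI : MeasurableSpace G := borel G
      haveI : BorelSpace G := ⟨rfl⟩
      ∀ (r : LatticeRep G) (M : ℕ) (_hM : 2 ≤ M),
        haveI : SecondCountableTopology G :=
          (r.continuous.isClosedEmbedding r.injective).isEmbedding.secondCountableTopology
        ∃ (K : ℕ) (θ₁ C : ℝ), 0 < θ₁ ∧ ∀ᶠ n : ℕ in atTop, ∃ β : ℝ, (n : ℝ) ≤ β ∧
          ∀ (S : ℕ) [NeZero S] [NeZero ((K + 1) * M ^ n * S)],
            (∀ᵐ U ∂(wilsonMeasure (d := 4) (L := (K + 1) * M ^ n * S) r.ρ β),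
              θ₁ * ((M : ℝ) ^ n)⁻¹ ^ 8 ≤
                ((wilsonMeasure (d := 4) (L := (K + 1) * M ^ n * S) r.ρ β)[
                    (fun U => actionDensity r.ρ (torusLift ((K + 1) * M ^ n * S) U)) *
                      (fun U => actionDensity r.ρ
                        (configShift (-Pi.single 0 ((M ^ n : ℕ) : ℤ)) (torusLift ((K + 1) * M ^ n * S) U)))
                    | MeasurableSpace.comap
                        (GaugeBlockAveraging.axial (d := 4) (G := G) ((K + 1) * M ^ n) S).link
                        inferInstance]) U -
                  ((wilsonMeasure (d := 4) (L := (K + 1) * M ^ n * S) r.ρ β)[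
                      (fun U => actionDensity r.ρ (torusLift ((K + 1) * M ^ n * S) U))
                      | MeasurableSpace.comap
                          (GaugeBlockAveraging.axial (d := 4) (G := G) ((K + 1) * M ^ n) S).link
                          inferInstance]) U *
                    ((wilsonMeasure (d := 4) (L := (K + 1) * M ^ n * S) r.ρ β)[
                        (fun U => actionDensity r.ρ
                          (configShift (-Pi.single 0 ((M ^ n : ℕ) : ℤ))
                            (torusLift ((K + 1) * M ^ n * S) U)))
                        | MeasurableSpace.comap
                            (GaugeBlockAveraging.axial (d := 4) (G := G) ((K + 1) * M ^ n) S).link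
                            inferInstance]) U) ∧
            ∃ a a' : ℝ,
              (∀ᵐ U ∂(wilsonMeasure (d := 4) (L := (K + 1) * M ^ n * S) r.ρ β),
                |((wilsonMeasure (d := 4) (L := (K + 1) * M ^ n * S) r.ρ β)[
                      (fun U => actionDensity r.ρ (torusLift ((K + 1) * M ^ n * S) U))
                      | MeasurableSpace.comap
                          (GaugeBlockAveraging.axial (d := 4) (G := G) ((K + 1) * M ^ n) S).link
                          inferInstance]) U - a| ≤ C / (((K : ℝ) + 1) * (M : ℝ) ^ n) ^ 4) ∧
              (∀ᵐ U ∂(wilsonMeasure (d := 4) (L := (K + 1) * M ^ n * S) r.ρ β),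
                |((wilsonMeasure (d := 4) (L := (K + 1) * M ^ n * S) r.ρ β)[
                      (fun U => actionDensity r.ρ
                        (configShift (-Pi.single 0 ((M ^ n : ℕ) : ℤ)) (torusLift ((K + 1) * M ^ n * S) U)))
                      | MeasurableSpace.comap
                          (GaugeBlockAveraging.axial (d := 4) (G := G) ((K + 1) * M ^ n) S).link
                          inferInstance]) U - a'| ≤ C / (((K : ℝ) + 1) * (M : ℝ) ^ n) ^ 4)

/-- Card 2, auxiliary class: a **plaquette-like** local observable of the (coarse) lattice gauge field
near the origin — measurable, gauge invariant, bounded, a cylinder on finitely many plaquettes `Pl`, with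
(i) quadratic GROWTH: `Φ ≤ CΦ · (total deficit of the plaquettes in Pl)`, and (ii) LOWER comparability
with the origin: `Φ ≥ z·(6N − P(origin)) − CΦ·(6N − P(origin))^{3/2}` (so its quadratic part dominates
`z` times the origin deficit in the PSD order, which by `tr(AΣBΣ) ≥ tr(aΣbΣ)` for `A ≥ a ≥ 0`,
`B ≥ b ≥ 0` makes the leading two-point coefficient at least that of the coarse plaquette deficit). The
block-AVERAGED blocked plaquette is intended to lie in this class (Jensen: the block average of `|F_bg|²`
dominates `|block flux|² = θ²/L'⁴`); the single blocked plaquette and the coarse Wilson density itself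
are NOT used as the coarse operator (the former is rank-deficient, the latter wrong at `O(θ⁴)`). -/
def IsPlaquetteLike {G : Type} [Group G] [MeasurableSpace G] {N : ℕ}
    (ρ : G →* Matrix (Fin N) (Fin N) ℂ) (z CΦ : ℝ) (Φ : LGConfig 4 G → ℝ) : Prop :=
  Measurable Φ ∧ IsZdGaugeInvariant Φ ∧ (∃ B : ℝ, ∀ U, |Φ U| ≤ B) ∧
    (∃ Pl : Finset (ZdPlaquette 4), IsCylinder Φ (Pl.biUnion plaquetteEdges) ∧
      ∀ U, Φ U ≤ CΦ * ∑ p ∈ Pl, ((N : ℝ) - plaquetteObs ρ p.1 p.2.1.1 p.2.1.2 U)) ∧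
    ∀ U, z * (6 * (N : ℝ) - actionDensity ρ U) -
        CΦ * (6 * (N : ℝ) - actionDensity ρ U) ^ (3 / 2 : ℝ) ≤ Φ U

/-- Card 2, first lemma (a): ONE-insertion linear transport of the BLOCK-AVERAGED fine plaquette down
Bałaban's flow ("the blocked block-average of the action density is a plaquette-like coarse observable").
There is `C` such that for every UV depth parameter `gs ∈ (0,1)` (the running coupling `g*` of the
window), for all large `n` some `β ≥ n` (block factor `Mⁿ`), a constant `c`, a normalisation
`z ∈ [1/2, 2]` (intended `∏ⱼ(1 + O(gⱼ⁴))`) and a plaquette-like `Φ` (constant `≤ C`, independent of the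
volume) satisfy on EVERY fine torus of side `Mⁿ·S`: (i) a.s. on the event that the axial block field `V`
is `gs`-small at the origin, the conditional expectation given `V` of the average of the fine action
density over the origin block is `c − M^{-4n}·Φ(V) ± C(gs⁶ + M^{-2n})·M^{-4n}`; (ii) the event "`V` not
`gs`-small at the origin" has probability `≤ C·gs⁶`, uniformly in `S` (compactness screen at the next
fixed scale). (By reflection positivity — `T ≥ 0`, a support item on odd tori — the crux's point–point
covariance at separation `D` dominates the block–block covariance of the origin block and a block ahead
of `D e₀`, so block averages are all the line needs.) -/
def TransportToCoarsePlaquette : Prop :=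
  ∀ (G : Type) [Group G] [TopologicalSpace G] [IsTopologicalGroup G] [CompactSpace G],
    IsCompactSimpleLieGroup G →
      letI : MeasurableSpace G := borel G
      haveI : BorelSpace G := ⟨rfl⟩
      ∀ (r : LatticeRep G) (M : ℕ) (_hM : 2 ≤ M),
        haveI : SecondCountableTopology G :=
          (r.continuous.isClosedEmbedding r.injective).isEmbedding.secondCountableTopology
        ∃ C : ℝ, ∀ gs : ℝ, 0 < gs → gs < 1 →
          ∀ᶠ n : ℕ in atTop, ∃ (β c z : ℝ) (Φ : LGConfig 4 G → ℝ), (n : ℝ) ≤ β ∧ 1 / 2 ≤ z ∧ z ≤ 2 ∧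
            IsPlaquetteLike r.ρ z C Φ ∧
            ∀ (S : ℕ) [NeZero S] [NeZero (M ^ n * S)],
              (∀ᵐ U ∂(wilsonMeasure (d := 4) (L := M ^ n * S) r.ρ β),
                6 * (r.N : ℝ) - actionDensity r.ρ (torusLift S
                    ((GaugeBlockAveraging.axial (d := 4) (G := G) (M ^ n) S).link U)) ≤ gs →
                |((wilsonMeasure (d := 4) (L := M ^ n * S) r.ρ β)[
                      (fun U => ((M : ℝ) ^ n)⁻¹ ^ 4 * ∑ x : Fin 4 → Fin (M ^ n),
                        actionDensity r.ρ
                          (configShift (fun i => -((x i : ℕ) : ℤ)) (torusLift (M ^ n * S) U)))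
                      | MeasurableSpace.comap
                          (GaugeBlockAveraging.axial (d := 4) (G := G) (M ^ n) S).link inferInstance]) U -
                    (c - ((M : ℝ) ^ n)⁻¹ ^ 4 *
                      Φ (torusLift S ((GaugeBlockAveraging.axial (d := 4) (G := G) (M ^ n) S).link U)))| ≤
                  C * (gs ^ 6 + ((M : ℝ) ^ n)⁻¹ ^ 2) * ((M : ℝ) ^ n)⁻¹ ^ 4) ∧
              (wilsonMeasure (d := 4) (L := M ^ n * S) r.ρ β)
                  {U | gs < 6 * (r.N : ℝ) - actionDensity r.ρ (torusLift S
                    ((GaugeBlockAveraging.axial (d := 4) (G := G) (M ^ n) S).link U))} ≤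
                ENNReal.ofReal (C * gs ^ 6)

/-- Card 2, first lemma (b): the FIXED-WINDOW lower bound, robust under Bałaban-format terms and
uniform in the volume, for plaquette-like observables. For every coarse separation `K' ≥ 1`, block side
`c`, format constants `(κ, B₀, C₀)` on the small-field domains of radius `rad` and threshold `ε`, and
every plaquette-like `Φ` (normalisation `z ∈ [1/2,2]`, constant `CΦ`), there are `β₀` and `c₁ > 0` such
that EVERY effective action `𝓔 = β·A(V) + ∑ E_X(V)` in format with `β ≥ β₀`, on every coarse torus of
side `S > 2K'`, has connected time-correlation of `Φ` at separation `K'` at least `c₁ β⁻² K'⁻⁸`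
(intended `c₁ → z²(T_r²/4)·c·dim G`, the two-gluon exchange; the `3/2`-homogeneous part of `Φ` is a
relative `O(β^{-1/2})` correction; analyticity of the terms on an `O(1)` complex neighbourhood makes
them a relative `O(β⁻¹)` perturbation; IR-uniformity in `S` by the compactness screen at the FIXED scale
`K·K'`). -/
def FixedWindowLowerBound : Prop :=
  ∀ (G : Type) [Group G] [TopologicalSpace G] [IsTopologicalGroup G] [CompactSpace G],
    IsCompactSimpleLieGroup G →
      letI : MeasurableSpace G := borel G
      haveI : BorelSpace G := ⟨rfl⟩
      ∀ (r : LatticeRep G) (c : ℕ) [NeZero c] (K' : ℕ) (κ B₀ C₀ rad ε z CΦ : ℝ) (Φ : LGConfig 4 G → ℝ),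
        1 ≤ K' → 0 < κ → 0 < rad → 0 < ε → 1 / 2 ≤ z → z ≤ 2 → IsPlaquetteLike r.ρ z CΦ Φ →
        ∃ β₀ c₁ : ℝ, 0 < c₁ ∧ ∀ (S : ℕ) [NeZero S] (𝓔 : BalabanEffectiveAction 4 S G c),
          2 * K' < S → 𝓔.InFormat r.ρ (smallFieldDomain r.ρ c rad ε) κ B₀ C₀ → β₀ ≤ 𝓔.β →
            c₁ / 𝓔.β ^ 2 ≤ (K' : ℝ) ^ 8 * 𝓔.terms.connectedCorr r.ρ 𝓔.β Φ Φ K'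

end Summit.QuantumFields.YangMills.Cruxes.TunedSequenceExists.Sketch
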